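import Summits.CriticalPhenomena.PercolationContinuityZ3.Theorems.PercNearOneGluingNoHeavyLowerTailSahiJuntaSlotCube
import Summits.CriticalPhenomena.PercolationContinuityZ3.Theorems.PercNearOneGluingNoHeavyLowerTailSahiTransportCert

/-!
# `NoHeavyLowerTail` (crux stmt-CriticalPhenomena-4575), Sahi / Kahn positivity: the two transport certificates on `2^3` as `TransportCert`s

Support file (cell `prim-l12`, seat P3, gen 4; `--supports stmt-CriticalPhenomena-4575`).  No `sorry`, no named facts, standard axioms.

The kernels of the `a ∨ bc` and majority certificates (`KrOrAnd`, `KrMaj`, defined through the codes of the patterns and the bitmask polynomials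
`mlT`), and the verification of the seven clauses of `SahiTransportCert.TransportCert` for them: support (`S ⊆ T`, `S ∉ H_k ∋ T`), nonnegativity,
ROW sums `θ·w(S)` (linear table identities), COLUMN bounds (the kernel-checked `colOrAnd…`/`colMaj…` of `…SahiTransportCheckCols`) and the
TRANSPORT CONDITION on all pairs of up-sets (the kernel-checked `tc_orAnd`/`tc_maj` of `…SahiTransportCheck`, transported through the dictionary of
`…SahiJuntaSlotCube`).  Results: `transportCert_orAnd q : TransportCert q (HkM 234) (KrOrAnd q)` and `transportCert_maj q : TransportCert q (HkM 232)
(KrMaj q)` for every `q : Fin 3 → [0,1]`. [this work]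
-/

noncomputable section

open scoped Classical

namespace Summit.CriticalPhenomena.PercolationContinuityZ3.Theorems

namespace SahiJuntaSlotThree

open Finset
open SahiHittingSlot SahiTransportCert SahiTransportCheck SahiC3Cube OneCutCert CovTransferCert
open Literature.Combinatorics.Sahi2008
open Literature.Probability.Percolation.DecisionTree (ind ind_of_mem ind_of_not_mem ind_nonneg)

/-! ### Point patterns: inclusions and the eight monomials -/

/-- Inclusion of point patterns from their bits. [this work] -/
theorem pt_subset {i j : ℕ} (h : ∀ k < 3, i.testBit k = true → j.testBit k = true) : pt 3 i ⊆ pt 3 j :=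
  fun k hk => by simp only [pt, Set.mem_setOf_eq] at hk ⊢; exact h k k.2 hk

/-- `w(∅)`. [this work] -/
theorem mlT_1 (x : Fin 3 → ℝ) : mlT 1 x = (1 - x 0) * (1 - x 1) * (1 - x 2) := by
  have hm := mlT_pow_eq_mono (j := 0) (by norm_num) x
  norm_num at hm
  rw [hm, mono_three]
  simp

/-- `w(a)`. [this work] -/
theorem mlT_2 (x : Fin 3 → ℝ) : mlT 2 x = x 0 * (1 - x 1) * (1 - x 2) := by
  have hm := mlT_pow_eq_mono (j := 1) (by norm_num) x
  norm_num at hm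
  rw [hm, mono_three]
  have h0 : Nat.testBit 1 0 = true := by decide
  have h1 : Nat.testBit 1 1 = false := by decide
  have h2 : Nat.testBit 1 2 = false := by decide
  simp [h0, h1, h2]

/-- `w(b)`. [this work] -/
theorem mlT_4 (x : Fin 3 → ℝ) : mlT 4 x = (1 - x 0) * x 1 * (1 - x 2) := by
  have hm := mlT_pow_eq_mono (j := 2) (by norm_num) x
  norm_num at hm
  rw [hm, mono_three]
  have h0 : Nat.testBit 2 0 = false := by decide
  have h1 : Nat.testBit 2 1 = true := by decide
  have h2 : Nat.testBit 2 2 = false := by decide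
  simp [h0, h1, h2]

/-- `w(ab)`. [this work] -/
theorem mlT_8 (x : Fin 3 → ℝ) : mlT 8 x = x 0 * x 1 * (1 - x 2) := by
  have hm := mlT_pow_eq_mono (j := 3) (by norm_num) x
  norm_num at hm
  rw [hm, mono_three]
  have h0 : Nat.testBit 3 0 = true := by decide
  have h1 : Nat.testBit 3 1 = true := by decide
  have h2 : Nat.testBit 3 2 = false := by decide
  simp [h0, h1, h2]

/-- `w(c)`. [this work] -/
theorem mlT_16 (x : Fin 3 → ℝ) : mlT 16 x = (1 - x 0) * (1 - x 1) * x 2 := by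
  have hm := mlT_pow_eq_mono (j := 4) (by norm_num) x
  norm_num at hm
  rw [hm, mono_three]
  have h0 : Nat.testBit 4 0 = false := by decide
  have h1 : Nat.testBit 4 1 = false := by decide
  have h2 : Nat.testBit 4 2 = true := by decide
  simp [h0, h1, h2]

/-- `w(ac)`. [this work] -/
theorem mlT_32 (x : Fin 3 → ℝ) : mlT 32 x = x 0 * (1 - x 1) * x 2 := by
  have hm := mlT_pow_eq_mono (j := 5) (by norm_num) x
  norm_num at hm
  rw [hm, mono_three]
  have h0 : Nat.testBit 5 0 = true := by decide
  have h1 : Nat.testBit 5 1 = false := by decide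
  have h2 : Nat.testBit 5 2 = true := by decide
  simp [h0, h1, h2]

/-- `w(bc)`. [this work] -/
theorem mlT_64 (x : Fin 3 → ℝ) : mlT 64 x = (1 - x 0) * x 1 * x 2 := by
  have hm := mlT_pow_eq_mono (j := 6) (by norm_num) x
  norm_num at hm
  rw [hm, mono_three]
  have h0 : Nat.testBit 6 0 = false := by decide
  have h1 : Nat.testBit 6 1 = true := by decide
  have h2 : Nat.testBit 6 2 = true := by decide
  simp [h0, h1, h2]

/-- `w(abc)`. [this work] -/
theorem mlT_128 (x : Fin 3 → ℝ) : mlT 128 x = x 0 * x 1 * x 2 := by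
  have hm := mlT_pow_eq_mono (j := 7) (by norm_num) x
  norm_num at hm
  rw [hm, mono_three]
  have h0 : Nat.testBit 7 0 = true := by decide
  have h1 : Nat.testBit 7 1 = true := by decide
  have h2 : Nat.testBit 7 2 = true := by decide
  simp [h0, h1, h2]

section Kernels

variable (q : Fin 3 → unitInterval)

/-- Double sums of a code kernel against an indicator. [this work] -/
theorem sum_sum_code (k : ℕ → ℕ → (Fin 3 → ℝ) → ℝ) (x : Fin 3 → ℝ) (𝒦 : Set (Set (Fin 3))) :
    ∑ S : Set (Fin 3), ∑ T : Set (Fin 3), k (code S) (code T) x * ind 𝒦 T =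
      ∑ i ∈ range 8, ∑ j ∈ range 8, k i j x * ind 𝒦 (pt 3 j) := by
  rw [sum_eq_sum_range]
  refine sum_congr rfl fun i hi => ?_
  rw [code_pt (mem_range.1 hi), sum_eq_sum_range]
  refine sum_congr rfl fun j hj => ?_
  rw [code_pt (mem_range.1 hj)]

/-- Row sums of a code kernel. [this work] -/
theorem sum_code_right (k : ℕ → ℕ → (Fin 3 → ℝ) → ℝ) (x : Fin 3 → ℝ) (S : Set (Fin 3)) :
    ∑ T : Set (Fin 3), k (code S) (code T) x = ∑ j ∈ range 8, k (code S) j x := by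
  rw [sum_eq_sum_range]
  exact sum_congr rfl fun j hj => by rw [code_pt (mem_range.1 hj)]

/-- Column sums of a code kernel. [this work] -/
theorem sum_code_left (k : ℕ → ℕ → (Fin 3 → ℝ) → ℝ) (x : Fin 3 → ℝ) (T : Set (Fin 3)) :
    ∑ S : Set (Fin 3), k (code S) (code T) x = ∑ i ∈ range 8, k i (code T) x := by
  rw [sum_eq_sum_range]
  exact sum_congr rfl fun i hi => by rw [code_pt (mem_range.1 hi)]

/-- The weight of a pattern through its code. [this work] -/
theorem bernoulliWeight_eq_mlT_code (S : Set (Fin 3)) : bernoulliWeight q S = mlT (2 ^ code S) (xq q) := by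
  conv_lhs => rw [← pt_code S]
  exact bernoulliWeight_pt_eq_mlT q (code_lt S)

/-! ### The `a ∨ bc` kernel -/

/-- The `a ∨ bc` kernel on codes: `(∅→a) = w(∅)p_a`, `(∅→bc) = w(∅)w(bc)`, `(b→ab) = w(b)p_a`, `(b→bc) = w(b)w(bc)`, `(c→ac) = w(c)p_a`,
`(c→bc) = w(c)w(bc)`. [this work] -/
def kO (i j : ℕ) (x : Fin 3 → ℝ) : ℝ :=
  if i = 0 ∧ j = 1 then mlT 1 x * mlT 170 x else
  if i = 0 ∧ j = 6 then mlT 1 x * mlT 64 x else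
  if i = 2 ∧ j = 3 then mlT 4 x * mlT 170 x else
  if i = 2 ∧ j = 6 then mlT 4 x * mlT 64 x else
  if i = 4 ∧ j = 5 then mlT 16 x * mlT 170 x else
  if i = 4 ∧ j = 6 then mlT 16 x * mlT 64 x else 0

/-- The `a ∨ bc` kernel on patterns. [this work] -/
def KrOrAnd (S T : Set (Fin 3)) : ℝ := kO (code S) (code T) (xq q)

/-- Support of the `a ∨ bc` kernel. [this work] -/
theorem kO_support {i j : ℕ} {x : Fin 3 → ℝ} (h : kO i j x ≠ 0) :
    (i = 0 ∧ (j = 1 ∨ j = 6)) ∨ (i = 2 ∧ (j = 3 ∨ j = 6)) ∨ (i = 4 ∧ (j = 5 ∨ j = 6)) := by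
  unfold kO at h
  split_ifs at h <;> first | omega | exact absurd rfl h

/-- Nonnegativity of the `a ∨ bc` kernel on the cube. [this work] -/
theorem kO_nonneg (i j : ℕ) {x : Fin 3 → ℝ} (hx : InCube x) : 0 ≤ kO i j x := by
  unfold kO
  split_ifs <;> first | exact le_rfl | exact mul_nonneg (mlT_nonneg _ hx) (mlT_nonneg _ hx)

/-- **The `a ∨ bc` transport certificate.** [this work] -/
theorem transportCert_orAnd : TransportCert q (HkM 234) (KrOrAnd q) := by
  have hx := inCube_xq q
  have hθ : 2 - pr q (HkM 234) = 1 + mlT 21 (xq q) := two_sub_pr_234 q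
  refine ⟨fun S T => kO_nonneg _ _ hx, ?_, ?_, ?_, ?_, ?_, ?_⟩
  · -- subset
    intro S T h
    rcases kO_support h with ⟨hi, hj | hj⟩ | ⟨hi, hj | hj⟩ | ⟨hi, hj | hj⟩ <;>
      (rw [← pt_code S, ← pt_code T, hi, hj]; exact pt_subset (by decide))
  · -- sources outside `H_k`
    intro S T h
    rw [mem_HkM]
    rcases kO_support h with ⟨hi, -⟩ | ⟨hi, -⟩ | ⟨hi, -⟩ <;> (rw [hi]; decide)
  · -- targets inside `H_k`
    intro S T h
    rw [mem_HkM]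
    rcases kO_support h with ⟨-, hj | hj⟩ | ⟨-, hj | hj⟩ | ⟨-, hj | hj⟩ <;> (rw [hj]; decide)
  · -- rows
    intro S hS
    unfold KrOrAnd
    rw [sum_code_right, pr_HkM, bernoulliWeight_eq_mlT_code q S]
    rw [mem_HkM] at hS
    have hc := code_lt S
    generalize code S = c at *
    interval_cases c
    · simp [Finset.sum_range_succ, kO, mlT_234]; ring
    · exact absurd (by decide) hS
    · simp [Finset.sum_range_succ, kO, mlT_234]; ring
    · exact absurd (by decide) hS
    · simp [Finset.sum_range_succ, kO, mlT_234]; ring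
    · exact absurd (by decide) hS
    · exact absurd (by decide) hS
    · exact absurd (by decide) hS
  · -- columns
    intro T
    unfold KrOrAnd
    rw [sum_code_left, hθ, bernoulliWeight_eq_mlT_code q T]
    have hc := code_lt T
    have h23 := mlT_nonneg 21 hx
    generalize code T = c at *
    interval_cases c
    · simp [kO]; exact mul_nonneg (by linarith) (mlT_nonneg _ hx)
    · have h := colOrAnd2 hx
      rw [show (2 : ℝ) - mlT 234 (xq q) = 1 + mlT 21 (xq q) by rw [← hθ, pr_HkM]] at h
      simp [kO]; linarith
    · simp [kO]; exact mul_nonneg (by linarith) (mlT_nonneg _ hx)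
    · have h := colOrAnd8 hx
      rw [show (2 : ℝ) - mlT 234 (xq q) = 1 + mlT 21 (xq q) by rw [← hθ, pr_HkM]] at h
      simp [kO]; linarith
    · simp [kO]; exact mul_nonneg (by linarith) (mlT_nonneg _ hx)
    · have h := colOrAnd32 hx
      rw [show (2 : ℝ) - mlT 234 (xq q) = 1 + mlT 21 (xq q) by rw [← hθ, pr_HkM]] at h
      simp [kO]; linarith
    · have h := colOrAnd64 hx
      rw [show (2 : ℝ) - mlT 234 (xq q) = 1 + mlT 21 (xq q) by rw [← hθ, pr_HkM]] at h
      rw [mlT_21] at h ⊢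
      simp [Finset.sum_range_succ, kO]; nlinarith [h]
    · simp [kO]; exact mul_nonneg (by linarith) (mlT_nonneg _ hx)
  · -- the transport condition
    intro 𝒳 𝒵 h𝒳 h𝒵
    have hX := encA_mem_upsN h𝒳
    have hZ := encA_mem_upsN h𝒵
    have h := tc_orAnd hX hZ hx
    unfold lhs6OrAnd rhs6 at h
    rw [gate_encA 𝒳 𝒵 (by norm_num : 1 < 8), gate_encA 𝒳 𝒵 (by norm_num : 3 < 8), gate_encA 𝒳 𝒵 (by norm_num : 5 < 8),
      gate_encA 𝒳 𝒵 (by norm_num : 6 < 8)] at h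
    unfold KrOrAnd
    rw [sum_sum_code, hθ, compl_HkM_234, pr_inter, pr_eq_mlT q 𝒳, pr_eq_mlT q 𝒵, pr_HkM_inter_inter, pr_HkM_inter, pr_HkM_inter]
    simp [Finset.sum_range_succ, kO]
    rw [mlT_21] at h ⊢
    nlinarith [h, ind_nonneg (𝒳 ∩ 𝒵) (pt 3 6)]

/-! ### The majority kernel -/

/-- The majority kernel on codes: `(∅→m) = w(∅)(w(m) + w(abc)/3)` for the three middle patterns `m`, and
`(x→x∪y) = w(x)(w(xy) + (w(abc) + w(m̄_x))/2)` for the six edges from a singleton. [this work] -/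
def kM (i j : ℕ) (x : Fin 3 → ℝ) : ℝ :=
  if i = 0 ∧ j = 3 then mlT 1 x * (mlT 8 x + mlT 128 x / 3) else
  if i = 0 ∧ j = 5 then mlT 1 x * (mlT 32 x + mlT 128 x / 3) else
  if i = 0 ∧ j = 6 then mlT 1 x * (mlT 64 x + mlT 128 x / 3) else
  if i = 1 ∧ j = 3 then mlT 2 x * (mlT 8 x + (mlT 128 x + mlT 64 x) / 2) else
  if i = 1 ∧ j = 5 then mlT 2 x * (mlT 32 x + (mlT 128 x + mlT 64 x) / 2) else
  if i = 2 ∧ j = 3 then mlT 4 x * (mlT 8 x + (mlT 128 x + mlT 32 x) / 2) else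
  if i = 2 ∧ j = 6 then mlT 4 x * (mlT 64 x + (mlT 128 x + mlT 32 x) / 2) else
  if i = 4 ∧ j = 5 then mlT 16 x * (mlT 32 x + (mlT 128 x + mlT 8 x) / 2) else
  if i = 4 ∧ j = 6 then mlT 16 x * (mlT 64 x + (mlT 128 x + mlT 8 x) / 2) else 0

/-- The majority kernel on patterns. [this work] -/
def KrMaj (S T : Set (Fin 3)) : ℝ := kM (code S) (code T) (xq q)

/-- Support of the majority kernel. [this work] -/
theorem kM_support {i j : ℕ} {x : Fin 3 → ℝ} (h : kM i j x ≠ 0) :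
    (i = 0 ∧ (j = 3 ∨ j = 5 ∨ j = 6)) ∨ (i = 1 ∧ (j = 3 ∨ j = 5)) ∨ (i = 2 ∧ (j = 3 ∨ j = 6)) ∨ (i = 4 ∧ (j = 5 ∨ j = 6)) := by
  unfold kM at h
  split_ifs at h <;> first | omega | exact absurd rfl h

/-- Nonnegativity of the majority kernel on the cube. [this work] -/
theorem kM_nonneg (i j : ℕ) {x : Fin 3 → ℝ} (hx : InCube x) : 0 ≤ kM i j x := by
  have h := fun T => mlT_nonneg T hx
  unfold kM
  split_ifs <;>
    first
    | exact le_rfl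
    | exact mul_nonneg (h _) (add_nonneg (h _) (div_nonneg (h _) (by norm_num)))
    | exact mul_nonneg (h _) (add_nonneg (h _) (div_nonneg (add_nonneg (h _) (h _)) (by norm_num)))

/-- **The majority transport certificate.** [this work] -/
theorem transportCert_maj : TransportCert q (HkM 232) (KrMaj q) := by
  have hx := inCube_xq q
  have hθ : 2 - pr q (HkM 232) = 1 + mlT 23 (xq q) := two_sub_pr_232 q
  have hθ' : (2 : ℝ) - mlT 232 (xq q) = 1 + mlT 23 (xq q) := by rw [← hθ, pr_HkM]
  refine ⟨fun S T => kM_nonneg _ _ hx, ?_, ?_, ?_, ?_, ?_, ?_⟩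
  · intro S T h
    rcases kM_support h with ⟨hi, hj | hj | hj⟩ | ⟨hi, hj | hj⟩ | ⟨hi, hj | hj⟩ | ⟨hi, hj | hj⟩ <;>
      (rw [← pt_code S, ← pt_code T, hi, hj]; exact pt_subset (by decide))
  · intro S T h
    rw [mem_HkM]
    rcases kM_support h with ⟨hi, -⟩ | ⟨hi, -⟩ | ⟨hi, -⟩ | ⟨hi, -⟩ <;> (rw [hi]; decide)
  · intro S T h
    rw [mem_HkM]
    rcases kM_support h with ⟨-, hj | hj | hj⟩ | ⟨-, hj | hj⟩ | ⟨-, hj | hj⟩ | ⟨-, hj | hj⟩ <;> (rw [hj]; decide)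
  · intro S hS
    unfold KrMaj
    rw [sum_code_right, pr_HkM, bernoulliWeight_eq_mlT_code q S]
    rw [mem_HkM] at hS
    have hc := code_lt S
    generalize code S = c at *
    interval_cases c
    · simp [Finset.sum_range_succ, kM, mlT_232]; ring
    · simp [Finset.sum_range_succ, kM, mlT_232]; ring
    · simp [Finset.sum_range_succ, kM, mlT_232]; ring
    · exact absurd (by decide) hS
    · simp [Finset.sum_range_succ, kM, mlT_232]; ring
    · exact absurd (by decide) hS
    · exact absurd (by decide) hS
    · exact absurd (by decide) hS
  · intro T
    unfold KrMaj
    rw [sum_code_left, hθ, bernoulliWeight_eq_mlT_code q T]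
    have hc := code_lt T
    have h23 := mlT_nonneg 23 hx
    generalize code T = c at *
    interval_cases c
    · simp [kM]; exact mul_nonneg (by linarith) (mlT_nonneg _ hx)
    · simp [kM]; exact mul_nonneg (by linarith) (mlT_nonneg _ hx)
    · simp [kM]; exact mul_nonneg (by linarith) (mlT_nonneg _ hx)
    · have h := colMaj8 hx
      rw [hθ'] at h
      simp [Finset.sum_range_succ, kM]; linarith
    · simp [kM]; exact mul_nonneg (by linarith) (mlT_nonneg _ hx)
    · have h := colMaj32 hx
      rw [hθ'] at h
      simp [Finset.sum_range_succ, kM]; linarith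
    · have h := colMaj64 hx
      rw [hθ'] at h
      simp [Finset.sum_range_succ, kM]; linarith
    · simp [kM]; exact mul_nonneg (by linarith) (mlT_nonneg _ hx)
  · intro 𝒳 𝒵 h𝒳 h𝒵
    have hX := encA_mem_upsN h𝒳
    have hZ := encA_mem_upsN h𝒵
    have h := tc_maj hX hZ hx
    unfold lhs6Maj rhs6 at h
    rw [gate_encA 𝒳 𝒵 (by norm_num : 3 < 8), gate_encA 𝒳 𝒵 (by norm_num : 5 < 8), gate_encA 𝒳 𝒵 (by norm_num : 6 < 8)] at h
    unfold KrMaj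
    rw [sum_sum_code, hθ, compl_HkM_232, pr_inter, pr_eq_mlT q 𝒳, pr_eq_mlT q 𝒵, pr_HkM_inter_inter, pr_HkM_inter, pr_HkM_inter]
    simp [Finset.sum_range_succ, kM]
    have i3 := ind_nonneg (𝒳 ∩ 𝒵) (pt 3 3)
    have i5 := ind_nonneg (𝒳 ∩ 𝒵) (pt 3 5)
    have i6 := ind_nonneg (𝒳 ∩ 𝒵) (pt 3 6)
    rw [mlT_23, mlT_1, mlT_2, mlT_4, mlT_8, mlT_16, mlT_32, mlT_64, mlT_128] at h ⊢
    nlinarith [h, i3, i5, i6]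

end Kernels

end SahiJuntaSlotThree

end Summit.CriticalPhenomena.PercolationContinuityZ3.Theorems
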